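import Summits.Ventures.GridStability.Models.SMIB
import Literature.MathematicalPhysics.PowerSystems.LyapunovFunctionFamilyClosedForm
import HarnessLib

/-!
# GridStability/Models/SMIBLff — the lossless single-machine(-or-converter)-infinite-bus model in Vu–Turitsyn's Lyapunov-functions-family form, with its SOLVER-FREE closed-form certified region (generic in the record)

Cell `gridfusion` (LADDER-GRIDFUSION; lit-6 01:35:11Z / 02:23:49Z «USES: lyap-1/model-3 — a second
certified region (beside the energy well) for InverterDroopRoa's instance of record and every
GFM-SMIB/VSM instance: n = 1, E = [1]»); seat gridfusion-model-3 (g4). Generic companion of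
model-1's `Models/SMIB.lean` (p460909: `SMIB`, `field`, `IsSolutionOn`, `IsEquilibrium`) and of lit-6's
`Literature/…/LyapunovFunctionFamily{RegionOfAttraction, ClosedForm}.lean` (p479780 / p483522 / p484126:
`System.swing`, `Certificate.swingClosedForm`, `swingClosedForm_well_subset_regionOfAttraction`,
`swingClosedForm_V_eq`); the `n = 1` worked example of that Literature file is lit-6's `TwoBus`
(p481312) — this file is its MODEL-SIDE generic form for ANY lossless SMIB record, so that every typed
instance (model-1's Kundur SMIB, model-3's droop / VSM grid-forming converters via
`InverterBridgesSMIB.toGridSMIB` p462458) gets the closed-form LFF region by ONE application.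

WHAT IS PROVED (all [folklore] bookkeeping around the cited theorems; no named facts):
* `SMIB.lffSystem p δs` — the record `p` (inertia `M`, damping `D`, coupling `P_M`) at the
  equilibrium angle `δs` as lit-6's `System.swing ![M] ![D] !![1] ![P_M] ![δs]` (one machine, one line
  to the bus); `lffState δs (δ, ω) = (δ − δs, ω)`; `lffSystem_field_lffState`: for a LOSSLESS record
  (`P_C = 0`, `γ = 0`) at an equilibrium angle, the LFF field at `lffState δs x` IS model-1's
  `SMIB.field x` (re-indexed) — identity, no approximation; `hasDerivWithinAt_lffState`: solutions are
  carried over (any time set).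
* `SMIB.lffEps`, `SMIB.lffCert` — the closed-form family member for weights `0 < c`, `0 < c'` with
  `c·M < c'·D` (`Q = [[cD, cM],[cM, c'M]]`, `K = c'P_M`, `H = cP_M`,
  `ε = cM(c'D − cM)/(cD + c'M)`; the three scalar side conditions of `swingClosedForm` DISCHARGED
  symbolically: `lffEps_pos`, `lffEps_lt`, `lffEps_sq`).
* `SMIB.lffGain_eq` — the certified Lyapunov function READ ON THE MODEL:
  `V(lffState δs (δ, ω)) − V(0) = ½(cD u² + 2cM u ω + c'M ω²) + c'P_M (cos δs − cos δ − u sin δs)`,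
  `u = δ − δs` (energy function with a cross term; for `c' = 1`, `c → 0` it tends to the energy function).
* `SMIB.lff_roa` — **the certified region, generic**: for every lossless record with `M, D, P_M > 0`,
  equilibrium angle `|δs| < π/2`, weights as above and every level `ℓ < c'·P_M·vtGap(δs)`
  (`vtGap δ = 2cos δ − (π − 2|δ|) sin|δ|`): along EVERY solution `(δ, ω)` of model-1's `SMIB.field`
  on `[0, ∞)` with `|δ(0) + δs| < π` and `V(lffState δs (δ(0), ω(0))) − V(0) ≤ ℓ`, for all `t ≥ 0`
  `|δ t + δs| < π` and the gain stays `≤ ℓ`, and `(δ t, ω t) → (δs, 0)`.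

THREE COLUMNS. CERTIFIED: the region statement for the MODEL = classical lossless SMIB swing ODE
`M δ̈ + D δ̇ + P_M sin δ = P_m` (model-1 `SMIB` with `P_C = 0`, `γ = 0`; Anderson–Fouad (2.41)–(2.42)
+ damping), CLASS = the well `{|δ + δs| < π, V − V(0) ≤ ℓ}`; inner estimate; NO semidefinite
programming, no numerics — scalar inequalities only. MODELLED: whichever typed instance is plugged in
(MODEL-VALIDITY MV-1 for machines; MV-6D + MV-P + MV-Ω for droop/VSM converters). VALIDATED: nothing.
No sentence of this file says a machine, a converter or a grid is stable.
-/

noncomputable section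

open Real Set Filter Topology Matrix
open Literature.MathematicalPhysics.PowerSystems
open Literature.MathematicalPhysics.PowerSystems.LyapunovFunctionFamily
open Literature.MathematicalPhysics.PowerSystems.ClassicalModel.LosslessSystem (vtGap)

namespace Summit.Ventures.GridStability.Models.SMIB

variable (p : SMIB)

/-! ## §1 The swing structure of an SMIB record and the state map -/

/-- The SMIB record `p` at the equilibrium angle `δs` in Vu–Turitsyn's bilinear form (3): lit-6's
`System.swing` with one machine (`M`, `D`) and one line to the infinite bus (`E = 1`, weight `P_M`,
equilibrium line angle `δs`). Intended for LOSSLESS records (`P_C = 0`, `γ = 0`), cf.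
`lffSystem_field_lffState`. [cite: VuTuritsyn2016, §II eq. (3)] -/
def lffSystem (δs : ℝ) : LyapunovFunctionFamily.System (Fin 1 ⊕ Fin 1) (Fin 1) :=
  LyapunovFunctionFamily.System.swing (fun _ : Fin 1 => p.M) (fun _ : Fin 1 => p.D)
    (1 : Matrix (Fin 1) (Fin 1) ℝ) (fun _ : Fin 1 => p.PM) (fun _ : Fin 1 => δs)

/-- The LFF state of an SMIB state `(δ, ω)`: `x₁ = δ − δs`, `x₂ = ω`. [folklore] -/
def lffState (δs : ℝ) (x : ℝ × ℝ) : Fin 1 ⊕ Fin 1 → ℝ := Sum.elim (fun _ => x.1 - δs) (fun _ => x.2)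

/-- The LFF velocity of an SMIB velocity `(v₁, v₂)` (the linear part of `lffState`). [folklore] -/
def lffVel (v : ℝ × ℝ) : Fin 1 ⊕ Fin 1 → ℝ := Sum.elim (fun _ => v.1) (fun _ => v.2)

/-- Angle component of the LFF state. [folklore] -/
@[simp] theorem lffState_inl (δs : ℝ) (x : ℝ × ℝ) (i : Fin 1) : lffState δs x (Sum.inl i) = x.1 - δs := rfl

/-- Speed component of the LFF state. [folklore] -/
@[simp] theorem lffState_inr (δs : ℝ) (x : ℝ × ℝ) (i : Fin 1) : lffState δs x (Sum.inr i) = x.2 := rfl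

/-- First component of the LFF velocity. [folklore] -/
@[simp] theorem lffVel_inl (v : ℝ × ℝ) (i : Fin 1) : lffVel v (Sum.inl i) = v.1 := rfl

/-- Second component of the LFF velocity. [folklore] -/
@[simp] theorem lffVel_inr (v : ℝ × ℝ) (i : Fin 1) : lffVel v (Sum.inr i) = v.2 := rfl

/-- `lffState δs (δs, 0) = 0`: the equilibrium is the origin of the LFF state. [folklore] -/
@[simp] theorem lffState_equilibrium (δs : ℝ) : lffState δs (δs, 0) = 0 := by
  funext s; rcases s with i | i <;> simp

/-- `Cx = x₁` (the single line angle deviation). [cite: VuTuritsyn2016, §II (display for C)] -/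
theorem lffSystem_C_mulVec (δs : ℝ) (y : Fin 1 ⊕ Fin 1 → ℝ) (k : Fin 1) :
    ((p.lffSystem δs).C *ᵥ y) k = y (Sum.inl 0) := by
  fin_cases k
  simp [lffSystem, System.swing, Matrix.mulVec, dotProduct, Fintype.sum_sum_type, Matrix.fromCols,
    Matrix.one_apply]

/-- The equilibrium line angle datum is `δs`. [folklore] -/
@[simp] theorem lffSystem_δs (δs : ℝ) (k : Fin 1) : (p.lffSystem δs).δs k = δs := by
  fin_cases k; rfl

/-- The angle equation of (3): `ẋ₁ = x₂`. [cite: VuTuritsyn2016, §II eq. (3)] -/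
theorem lffSystem_field_inl (δs : ℝ) (y : Fin 1 ⊕ Fin 1 → ℝ) :
    (p.lffSystem δs).field y (Sum.inl 0) = y (Sum.inr 0) := by
  simp [lffSystem, System.swing, System.field, System.nonlin, Matrix.mulVec, dotProduct,
    Fintype.sum_sum_type, Matrix.fromBlocks, Matrix.fromRows]

/-- The speed equation of (3): `ẋ₂ = −(D/M) x₂ − (P_M/M)(sin(δs + x₁) − sin δs)`.
[cite: VuTuritsyn2016, §II eq. (3)] -/
theorem lffSystem_field_inr (δs : ℝ) (y : Fin 1 ⊕ Fin 1 → ℝ) :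
    (p.lffSystem δs).field y (Sum.inr 0)
      = -(p.D / p.M) * y (Sum.inr 0) - 1 / p.M * p.PM * (sin (δs + y (Sum.inl 0)) - sin δs) := by
  simp [lffSystem, System.swing, System.field, System.nonlin, Matrix.mulVec, dotProduct,
    Fintype.sum_sum_type, Matrix.fromBlocks, Matrix.fromRows, Matrix.fromCols, Matrix.mul_apply,
    Matrix.diagonal, Matrix.one_apply]

/-- Membership in Vu–Turitsyn's polytope `𝒫` read on the SMIB angle: `|δ + δs| < π`.
[cite: VuTuritsyn2016, §IV (definition of 𝒫)] -/
theorem lffState_mem_polytope_iff (δs : ℝ) (x : ℝ × ℝ) :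
    lffState δs x ∈ (p.lffSystem δs).polytope ↔ |x.1 + δs| < π := by
  constructor
  · intro h
    have h0 := h 0
    rw [lffSystem_C_mulVec, lffSystem_δs] at h0
    have e : δs + lffState δs x (Sum.inl 0) + δs = x.1 + δs := by simp only [lffState_inl]; ring
    rwa [e] at h0
  · intro h k
    fin_cases k
    show |((p.lffSystem δs).δs 0 + ((p.lffSystem δs).C *ᵥ lffState δs x) 0) + (p.lffSystem δs).δs 0| < π
    rw [lffSystem_C_mulVec, lffSystem_δs]
    have e : δs + lffState δs x (Sum.inl 0) + δs = x.1 + δs := by simp only [lffState_inl]; ring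
    rwa [e]

/-- `ker E = 0` for `E = 1`. [folklore] -/
theorem lff_kerE (v : Fin 1 → ℝ) (hv : (1 : Matrix (Fin 1) (Fin 1) ℝ) *ᵥ v = 0) : v = 0 := by
  simpa using hv

/-- `CB = 0` for the SMIB swing structure. [cite: VuTuritsyn2016, Appendix 9.1] -/
theorem lffSystem_C_mul_B (δs : ℝ) : (p.lffSystem δs).C * (p.lffSystem δs).B = 0 :=
  LyapunovFunctionFamily.System.swing_C_mul_B _ _ _ _ _

/-- The observability condition for the SMIB swing structure (`ker E = 0`).
[cite: VuTuritsyn2016, Appendix 9.2] -/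
theorem lffSystem_obs (δs : ℝ) (y : Fin 1 ⊕ Fin 1 → ℝ) (h1 : (p.lffSystem δs).C *ᵥ y = 0)
    (h2 : (p.lffSystem δs).C *ᵥ ((p.lffSystem δs).A *ᵥ y) = 0) : y = 0 :=
  LyapunovFunctionFamily.System.swing_obs _ _ _ _ _ lff_kerE y h1 h2

/-! ## §2 The LFF field IS model-1's SMIB field (lossless record, at an equilibrium angle) -/

/-- **Vector fields agree.** For a lossless record (`P_C = 0`, `γ = 0`, `M ≠ 0`) and an equilibrium
angle `δs` (`P_M sin δs = P_m`), the LFF field at `lffState δs x` is model-1's `SMIB.field x` in LFF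
indexing — identity, no approximation. [folklore] -/
theorem lffSystem_field_lffState (hM : p.M ≠ 0) (hPC : p.PC = 0) (hγ : p.γ = 0) {δs : ℝ}
    (hδs : p.IsEquilibrium δs) (x : ℝ × ℝ) :
    (p.lffSystem δs).field (lffState δs x) = lffVel (p.field x) := by
  have hPm : p.Pm = p.PM * sin δs := by
    have h := (p.isEquilibrium_iff δs).1 hδs
    rw [hγ, hPC, sub_zero, sub_zero] at h
    exact h.symm
  funext s
  rcases s with i | i <;> fin_cases i
  · show (p.lffSystem δs).field (lffState δs x) (Sum.inl 0) = lffVel (p.field x) (Sum.inl 0)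
    rw [lffSystem_field_inl]
    simp [SMIB.field]
  · show (p.lffSystem δs).field (lffState δs x) (Sum.inr 0) = lffVel (p.field x) (Sum.inr 0)
    rw [lffSystem_field_inr]
    simp only [lffState_inl, lffState_inr, lffVel_inr, SMIB.field, SMIB.Pe, hPC, hγ, hPm, sub_zero,
      zero_add, add_sub_cancel]
    field_simp
    ring

/-- **Solutions correspond** (any time set): along a curve with `ẋ = SMIB.field x` within `s` at
`t`, the LFF state has derivative the LFF field there. [folklore] -/
theorem hasDerivWithinAt_lffState (hM : p.M ≠ 0) (hPC : p.PC = 0) (hγ : p.γ = 0) {δs : ℝ}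
    (hδs : p.IsEquilibrium δs) {x : ℝ → ℝ × ℝ} {s : Set ℝ} {t : ℝ}
    (hx : HasDerivWithinAt x (p.field (x t)) s t) :
    HasDerivWithinAt (fun τ => lffState δs (x τ)) ((p.lffSystem δs).field (lffState δs (x t))) s t := by
  rw [p.lffSystem_field_lffState hM hPC hγ hδs]
  have h1 : HasDerivWithinAt (fun τ => (x τ).1) (p.field (x t)).1 s t := by
    simpa using hx.hasFDerivWithinAt.fst.hasDerivWithinAt
  have h2 : HasDerivWithinAt (fun τ => (x τ).2) (p.field (x t)).2 s t := by
    simpa using hx.hasFDerivWithinAt.snd.hasDerivWithinAt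
  refine hasDerivWithinAt_pi.2 fun s' => ?_
  rcases s' with i | i <;> fin_cases i
  · simpa using h1.sub_const δs
  · simpa using h2

/-! ## §3 The closed-form family member (weights `c`, `c'`; coercivity margin `ε` discharged) -/

/-- The coercivity margin `ε = cM(c'D − cM)/(cD + c'M)` of the `2 × 2` block `[[cD, cM],[cM, c'M]]`
(`= det/trace ≤ λ_min`). [folklore] -/
def lffEps (c c' : ℝ) : ℝ := c * p.M * (c' * p.D - c * p.M) / (c * p.D + c' * p.M)

/-- `ε > 0` when `M, D > 0`, `0 < c`, `0 < c'`, `cM < c'D`. [folklore] -/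
theorem lffEps_pos (hM : 0 < p.M) (hD : 0 < p.D) {c c' : ℝ} (hc : 0 < c) (hc' : 0 < c')
    (hcc' : c * p.M < c' * p.D) : 0 < p.lffEps c c' := by
  unfold lffEps
  have h1 : 0 < c * p.M := mul_pos hc hM
  have h2 : 0 < c' * p.D - c * p.M := by linarith
  have h3 : 0 < c * p.D + c' * p.M := by positivity
  positivity

/-- `ε < cD`. [folklore] -/
theorem lffEps_lt (hM : 0 < p.M) (hD : 0 < p.D) {c c' : ℝ} (hc : 0 < c) (hc' : 0 < c') :
    p.lffEps c c' < c * p.D := by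
  unfold lffEps
  have h3 : 0 < c * p.D + c' * p.M := by positivity
  rw [div_lt_iff₀ h3]
  nlinarith [mul_pos hc hM, mul_pos hc hD, mul_pos hc' hM, mul_pos (mul_pos hc hM) (mul_pos hc hM)]

/-- `(cM)² ≤ (cD − ε)(c'M − ε)` — indeed `(cD − ε)(c'M − ε) = (cM)² + ε²`. [folklore] -/
theorem lffEps_sq (hM : 0 < p.M) (hD : 0 < p.D) {c c' : ℝ} (hc : 0 < c) (hc' : 0 < c') :
    (c * p.M) ^ 2 ≤ (c * p.D - p.lffEps c c') * (c' * p.M - p.lffEps c c') := by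
  have h3 : c * p.D + c' * p.M ≠ 0 := by positivity
  have e : (c * p.D - p.lffEps c c') * (c' * p.M - p.lffEps c c') = (c * p.M) ^ 2 + p.lffEps c c' ^ 2 := by
    unfold lffEps
    field_simp
    ring
  rw [e]
  nlinarith [sq_nonneg (p.lffEps c c')]

/-- **The closed-form Vu–Turitsyn certificate of a lossless SMIB record** (lit-6's
`Certificate.swingClosedForm`, `n = 1`): weights `0 < c`, `0 < c'` with `cM < c'D`; `Q = [[cD, cM],
[cM, c'M]]`, `K = c'P_M`, `H = cP_M`, `ε = lffEps`. Every hypothesis of the constructor is a scalar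
inequality on `(M, D, P_M, c, c')`, discharged here. NO semidefinite programming.
[cite: VuTuritsyn2016, §III eq. (QKH)] -/
def lffCert (δs : ℝ) (hM : 0 < p.M) (hD : 0 < p.D) (hPM : 0 < p.PM) {c c' : ℝ} (hc : 0 < c)
    (hc' : 0 < c') (hcc' : c * p.M < c' * p.D) : Certificate (p.lffSystem δs) :=
  Certificate.swingClosedForm (fun _ : Fin 1 => p.M) (fun _ : Fin 1 => p.D)
    (1 : Matrix (Fin 1) (Fin 1) ℝ) (fun _ : Fin 1 => p.PM) (fun _ : Fin 1 => δs) c c' (p.lffEps c c')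
    (fun _ => hM) (fun _ => hPM) hc hc'.le (fun _ => hcc'.le) (p.lffEps_pos hM hD hc hc' hcc')
    (fun _ => p.lffEps_lt hM hD hc hc') (fun _ => p.lffEps_sq hM hD hc hc')

/-- The `K` datum of the closed-form certificate is `c'·P_M`. [folklore] -/
theorem lffCert_kK (δs : ℝ) (hM : 0 < p.M) (hD : 0 < p.D) (hPM : 0 < p.PM) {c c' : ℝ} (hc : 0 < c)
    (hc' : 0 < c') (hcc' : c * p.M < c' * p.D) (k : Fin 1) :
    (p.lffCert δs hM hD hPM hc hc' hcc').kK k = c' * p.PM := rfl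

/-- **The certified Lyapunov function read on the model**:
`V(lffState δs (δ, ω)) = ½(cD u² + 2cM u ω + c'M ω²) − c'P_M (cos δ + δ sin δs)`, `u = δ − δs`
(lit-6's `swingClosedForm_V_eq`, `n = 1`). [cite: VuTuritsyn2016, §III eq. (Lyapunov)] -/
theorem lffCert_V_lffState (δs : ℝ) (hM : 0 < p.M) (hD : 0 < p.D) (hPM : 0 < p.PM) {c c' : ℝ}
    (hc : 0 < c) (hc' : 0 < c') (hcc' : c * p.M < c' * p.D) (x : ℝ × ℝ) :
    (p.lffCert δs hM hD hPM hc hc' hcc').V (lffState δs x)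
      = 1 / 2 * (c * p.D * (x.1 - δs) ^ 2 + 2 * (c * p.M) * (x.1 - δs) * x.2 + c' * p.M * x.2 ^ 2)
        - c' * p.PM * (cos x.1 + x.1 * sin δs) := by
  have h := Certificate.swingClosedForm_V_eq (fun _ : Fin 1 => p.M) (fun _ : Fin 1 => p.D)
    (1 : Matrix (Fin 1) (Fin 1) ℝ) (fun _ : Fin 1 => p.PM) (fun _ : Fin 1 => δs) c c' (p.lffEps c c')
    (fun _ => hM) (fun _ => hPM) hc hc'.le (fun _ => hcc'.le) (p.lffEps_pos hM hD hc hc' hcc')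
    (fun _ => p.lffEps_lt hM hD hc hc') (fun _ => p.lffEps_sq hM hD hc hc') (lffState δs x)
  refine Eq.trans ?_ (h.trans ?_)
  · rfl
  · simp [Matrix.mulVec, dotProduct, Matrix.one_apply]

/-- `V(0) = −c'P_M(cos δs + δs sin δs)`. [cite: VuTuritsyn2016, §III eq. (Lyapunov)] -/
theorem lffCert_V_zero (δs : ℝ) (hM : 0 < p.M) (hD : 0 < p.D) (hPM : 0 < p.PM) {c c' : ℝ}
    (hc : 0 < c) (hc' : 0 < c') (hcc' : c * p.M < c' * p.D) :
    (p.lffCert δs hM hD hPM hc hc' hcc').V 0 = -(c' * p.PM * (cos δs + δs * sin δs)) := by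
  have h := p.lffCert_V_lffState δs hM hD hPM hc hc' hcc' (δs, 0)
  rw [lffState_equilibrium] at h
  rw [h]
  ring

/-- The GAIN of the certified Lyapunov function over the equilibrium, on the model:
`V(lffState δs (δ, ω)) − V(0) = ½(cD u² + 2cM u ω + c'M ω²) + c'P_M(cos δs − cos δ − u sin δs)` —
`c'`·(energy-function potential) + kinetic/cross quadratic. Only `sin δs`, `cos δs` enter (rational
for A1 instances). [folklore] -/
theorem lffGain_eq (δs : ℝ) (hM : 0 < p.M) (hD : 0 < p.D) (hPM : 0 < p.PM) {c c' : ℝ}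
    (hc : 0 < c) (hc' : 0 < c') (hcc' : c * p.M < c' * p.D) (x : ℝ × ℝ) :
    (p.lffCert δs hM hD hPM hc hc' hcc').V (lffState δs x) - (p.lffCert δs hM hD hPM hc hc' hcc').V 0
      = 1 / 2 * (c * p.D * (x.1 - δs) ^ 2 + 2 * (c * p.M) * (x.1 - δs) * x.2 + c' * p.M * x.2 ^ 2)
        + c' * p.PM * (cos δs - cos x.1 - (x.1 - δs) * sin δs) := by
  rw [lffCert_V_lffState, lffCert_V_zero]
  ring

/-! ## §4 The certified region for SMIB solutions (generic; hypotheses = scalar data facts) -/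

/-- **LFF closed-form region of attraction of a lossless SMIB record — generic, solver-free.**
MODEL: model-1's classical SMIB ODE `SMIB.field` (`δ̇ = ω`, `M ω̇ = P_m − P_M sin δ − D ω`; record
with `P_C = 0`, `γ = 0`, `M, D, P_M > 0`) at an equilibrium angle `δs` with `|δs| < π/2`; weights
`0 < c`, `0 < c'`, `cM < c'D`. STATEMENT: for every level `ℓ < c'·P_M·vtGap(δs)`
(`vtGap δ = 2cos δ − (π − 2|δ|) sin|δ|`, lit-6) and EVERY solution `x = (δ, ω)` on `[0, ∞)` with
`|δ(0) + δs| < π` and gain `V(lffState δs x(0)) − V(0) ≤ ℓ` (`lffGain_eq`): for all `t ≥ 0`,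
`|δ t + δs| < π` and the gain stays `≤ ℓ`; and `(δ t, ω t) → (δs, 0)`. Transport of lit-6's
`swingClosedForm_well_subset_regionOfAttraction` (third construction, `q = 0`) along
`hasDerivWithinAt_lffState`. CERTIFIED for the model, CLASS = the well; inner estimate; no sentence
here says a machine or converter is stable. [cite: VuTuritsyn2016, §IV (set ℛ, third construction)] -/
theorem lff_roa (hM : 0 < p.M) (hD : 0 < p.D) (hPM : 0 < p.PM) (hPC : p.PC = 0) (hγ : p.γ = 0)
    {δs : ℝ} (hδs : |δs| < π / 2) (heq : p.IsEquilibrium δs) {c c' : ℝ} (hc : 0 < c) (hc' : 0 < c')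
    (hcc' : c * p.M < c' * p.D) {ℓ : ℝ} (hℓ : ℓ < c' * p.PM * vtGap δs)
    {x : ℝ → ℝ × ℝ} (hx : p.IsSolutionOn x (Ici 0)) (h0P : |(x 0).1 + δs| < π)
    (h0V : (p.lffCert δs hM hD hPM hc hc' hcc').V (lffState δs (x 0))
      - (p.lffCert δs hM hD hPM hc hc' hcc').V 0 ≤ ℓ) :
    (∀ t, 0 ≤ t → |(x t).1 + δs| < π ∧
        (p.lffCert δs hM hD hPM hc hc' hcc').V (lffState δs (x t))
          - (p.lffCert δs hM hD hPM hc hc' hcc').V 0 ≤ ℓ) ∧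
      Tendsto x atTop (𝓝 (δs, 0)) := by
  set Λ := p.lffCert δs hM hD hPM hc hc' hcc' with hΛ
  -- the closed-form theorem (third construction, `q = 0`), level `c₀ = V 0 + ℓ`
  have hc₀ : ∀ k : Fin 1, Λ.V 0 + ℓ < Λ.V 0 + Λ.kK k * vtGap ((p.lffSystem δs).δs k) := by
    intro k
    rw [lffCert_kK, lffSystem_δs]
    linarith
  have hy : lffState δs (x 0) ∈ (p.lffSystem δs).polytope :=
    (p.lffState_mem_polytope_iff δs (x 0)).2 h0P
  have hyc : Λ.V (lffState δs (x 0)) ≤ Λ.V 0 + ℓ := by linarith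
  have key := Λ.well_subset_regionOfAttraction_of_gap₀ (p.lffSystem_C_mul_B δs)
    (fun k => by rw [lffSystem_δs]; exact hδs) (p.lffSystem_obs δs) hc₀ hy hyc
  obtain ⟨-, hall⟩ := key
  have hsol : ∀ T : ℝ, ∀ t ∈ Icc 0 T, HasDerivWithinAt (fun τ => lffState δs (x τ))
      ((p.lffSystem δs).field (lffState δs (x t))) (Icc 0 T) t := by
    intro T t ht
    exact (p.hasDerivWithinAt_lffState hM.ne' hPC hγ heq (hx t ht.1)).mono
      (fun τ hτ => (hτ.1 : 0 ≤ τ))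
  obtain ⟨hstay, htend⟩ := hall (fun τ => lffState δs (x τ)) rfl hsol
  refine ⟨fun t ht => ⟨(p.lffState_mem_polytope_iff δs (x t)).1 (hstay t ht).1, ?_⟩, ?_⟩
  · have := (hstay t ht).2; linarith
  · -- `lffState δs (x t) → 0` ⇒ `x t → (δs, 0)`
    have h := tendsto_pi_nhds.1 htend
    have h1 : Tendsto (fun t => (x t).1 - δs) atTop (𝓝 0) := by simpa using h (Sum.inl 0)
    have h2 : Tendsto (fun t => (x t).2) atTop (𝓝 0) := by simpa using h (Sum.inr 0)
    have h1' : Tendsto (fun t => (x t).1) atTop (𝓝 δs) := by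
      have := h1.add_const δs; simpa using this
    have := h1'.prodMk_nhds h2
    simpa using this

end Summit.Ventures.GridStability.Models.SMIB

end
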